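import Summits.Ventures.HodgeRepro.Primitive

/-!
# Faces of twisted CM types: the reduction lemma (Lemma R of `route/ROUTE.md` §7.7, combinatorial core)

Blind re-derivation cell `pub-hodge-repro`, seat `typer` (gen 2).  Continues `HodgeSets.lean` /
`Primitive.lean`.

A *face* is a finite family of CM types `T i` of the Galois CM field `F` (`i : ι`, `|ι| = 4` in the
rank-four census) with the `SumTwo` property: every embedding lies in exactly two of the `T i`
(the corner product `B = ∏ A_{T i}` then carries the Weil line `⊕_s ⊗_i H¹(A_{T i})_s` of Hodge type
`(2, 2)`; Deligne LNM 900 §5 (c) / Milne 2020 §2.2 in the printed sources).  Sort the corners into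
*isogeny classes* `j i ∈ J` with representatives `Φ k` (`k : J`): `T i = Φ (j i) · g i` is the
representative type read through the twist (automorphism) `g i ∈ G` (`rmul`, `Primitive.lean`), so that
`A_{T i} ≅ A_{Φ (j i)}` with `F` acting through `g i`.

**Lemma R (combinatorial core).**  Fix an embedding `s`.  The `s`-line of the Weil class of `B` is, on the
reduced product `B_red = ∏_k A_{Φ k}`, the line indexed by the *reduced set*
`U_s = {(j i, s · (g i)⁻¹) : i} ⊆ ⊔_k Hom(F, ℂ) = J × G`, and `U_s` satisfies Pohlmann's criterion for
the product CM type `(Φ k)_k`: for every `τ ∈ G`, exactly two of its elements `(k, y)` have `τ y ∈ Φ k`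
(and exactly two have `τ y ∈ c Φ k`).  When the pairs `(j i, g i)` are pairwise distinct, `U_s` has
`|ι|` elements.  In the single-class case (`J = Unit`) this says that `{s (g i)⁻¹ : i} ⊆ G` is a
Pohlmann set of `Φ` itself (`isHodgeSet_twistSet`).

Nothing geometric is used: the statement is the identity
`τ · (s (g i)⁻¹) ∈ Φ (j i)  ↔  τ s ∈ Φ (j i) · g i = T i`, summed over `i`.
-/

open Finset
open scoped Pointwise

namespace HodgeRepro

variable {G : Type*} [Group G]

/-! ### Faces: corners, `SumTwo`, reduced sets, the product criterion -/

/-- The corners of a face with class map `j`, representatives `Φ` and twists `g`: `T i = Φ (j i) · g i`. -/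
def corner {ι J : Type*} (Φ : J → Finset G) (j : ι → J) (g : ι → G) (i : ι) : Finset G :=
  rmul (Φ (j i)) (g i)

/-- Membership in a corner: `x ∈ Φ (j i) · g i ↔ x (g i)⁻¹ ∈ Φ (j i)`. -/
theorem mem_corner {ι J : Type*} (Φ : J → Finset G) (j : ι → J) (g : ι → G) (i : ι) (x : G) :
    x ∈ corner Φ j g i ↔ x * (g i)⁻¹ ∈ Φ (j i) := by
  simp [corner]

/-- `SumTwo`: every embedding lies in exactly two of the corners `T i`. -/
def SumTwo {ι : Type*} [Fintype ι] [DecidableEq G] (T : ι → Finset G) : Prop :=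
  ∀ x : G, (univ.filter fun i => x ∈ T i).card = 2

/-- The reduced set of a face at the embedding `s`: the pairs `(class of i, s · (g i)⁻¹)`. -/
def reducedSet {ι J : Type*} [Fintype ι] [DecidableEq J] [DecidableEq G] (j : ι → J) (g : ι → G)
    (s : G) : Finset (J × G) :=
  univ.image fun i => (j i, s * (g i)⁻¹)

/-- Membership in the reduced set. -/
theorem mem_reducedSet {ι J : Type*} [Fintype ι] [DecidableEq J] [DecidableEq G] (j : ι → J)
    (g : ι → G) (s : G) (q : J × G) : q ∈ reducedSet j g s ↔ ∃ i, (j i, s * (g i)⁻¹) = q := by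
  simp [reducedSet]

/-- Pohlmann's condition (9.2.1) for a subset `Δ` of `⊔_k Hom(F, ℂ) = J × G` with respect to the
product CM type `(Φ k)_k` (the abelian variety `∏_k A_{Φ k}` with CM algebra `F^J`):
`|τΔ ∩ Φ_prod| = |τΔ ∩ c Φ_prod|` for every `τ ∈ G`, where `τ` acts on the embedding coordinate. -/
def IsHodgeSetProd {J : Type*} [DecidableEq G] (c : G) (Φ : J → Finset G) (Δ : Finset (J × G)) :
    Prop :=
  ∀ τ : G, (Δ.filter fun q => τ * q.2 ∈ Φ q.1).card = (Δ.filter fun q => τ * q.2 ∈ c • Φ q.1).card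

section Faces

variable {ι J : Type*} [Fintype ι] [DecidableEq J] [DecidableEq G]

/-- Counting over the reduced set is counting over the corners, when the pairs `(j i, g i)` are
pairwise distinct. -/
theorem card_filter_reducedSet (j : ι → J) (g : ι → G) (hinj : Function.Injective fun i => (j i, g i))
    (s : G) (P : J × G → Prop) [DecidablePred P] :
    ((reducedSet j g s).filter P).card = (univ.filter fun i => P (j i, s * (g i)⁻¹)).card := by
  have hf : Function.Injective fun i => (j i, s * (g i)⁻¹) := by
    intro a b h
    simp only [Prod.mk.injEq] at h
    exact hinj (Prod.ext h.1 (by have := h.2; simpa using this))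
  unfold reducedSet
  rw [Finset.filter_image, Finset.card_image_of_injective _ hf]

/-- The reduced set has as many elements as the face has corners. -/
theorem card_reducedSet (j : ι → J) (g : ι → G) (hinj : Function.Injective fun i => (j i, g i))
    (s : G) : (reducedSet j g s).card = Fintype.card ι := by
  have hf : Function.Injective fun i => (j i, s * (g i)⁻¹) := by
    intro a b h
    simp only [Prod.mk.injEq] at h
    exact hinj (Prod.ext h.1 (by have := h.2; simpa using this))
  unfold reducedSet
  rw [Finset.card_image_of_injective _ hf, Finset.card_univ]

/-- **Lemma R, combinatorial core.**  For a face with `SumTwo` and pairwise distinct `(class, twist)`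
pairs, the reduced set at every embedding `s` satisfies Pohlmann's criterion for the product CM type
`(Φ k)_k`: exactly two of its elements `(k, y)` have `τ y ∈ Φ k`, and exactly two have `τ y ∈ c Φ k`. -/
theorem isHodgeSetProd_reducedSet {c : G} (hc : IsComplexConj c) (Φ : J → Finset G) (j : ι → J)
    (g : ι → G) (hinj : Function.Injective fun i => (j i, g i)) (hsum : SumTwo (corner Φ j g))
    (s : G) : IsHodgeSetProd c Φ (reducedSet j g s) := by
  intro τ
  rw [card_filter_reducedSet j g hinj, card_filter_reducedSet j g hinj]
  have key : ∀ (x : G) (i : ι), x * (s * (g i)⁻¹) ∈ Φ (j i) ↔ x * s ∈ corner Φ j g i := by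
    intro x i
    rw [mem_corner, mul_assoc]
  have h1 : (univ.filter fun i => τ * (s * (g i)⁻¹) ∈ Φ (j i)).card = 2 := by
    simp only [key]; exact hsum (τ * s)
  have h2 : (univ.filter fun i => τ * (s * (g i)⁻¹) ∈ c • Φ (j i)).card = 2 := by
    have key' : ∀ i, τ * (s * (g i)⁻¹) ∈ c • Φ (j i) ↔ c * τ * s ∈ corner Φ j g i := by
      intro i
      rw [hc.mem_smul_iff, ← mul_assoc, key]
    simp only [key']; exact hsum (c * τ * s)
  rw [h1, h2]

/-- The weight form of Lemma R: exactly two elements of the reduced set lie in `τ Φ_prod`. -/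
theorem card_filter_reducedSet_eq_two (Φ : J → Finset G) (j : ι → J) (g : ι → G)
    (hinj : Function.Injective fun i => (j i, g i)) (hsum : SumTwo (corner Φ j g)) (s τ : G) :
    ((reducedSet j g s).filter fun q => τ * q.2 ∈ Φ q.1).card = 2 := by
  rw [card_filter_reducedSet j g hinj]
  have key : ∀ i, τ * (s * (g i)⁻¹) ∈ Φ (j i) ↔ τ * s ∈ corner Φ j g i := by
    intro i; rw [mem_corner, mul_assoc]
  simp only [key]; exact hsum (τ * s)

end Faces

/-! ### The single-class case: a Pohlmann set of `Φ` itself -/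

section SingleClass

variable {ι : Type*} [Fintype ι] [DecidableEq G]

/-- The twist set `{s · (g i)⁻¹ : i} ⊆ G` of a single-class face at the embedding `s`. -/
def twistSet (g : ι → G) (s : G) : Finset G := univ.image fun i => s * (g i)⁻¹

/-- The twist set of pairwise distinct twists has `|ι|` elements. -/
theorem card_twistSet (g : ι → G) (hg : Function.Injective g) (s : G) :
    (twistSet g s).card = Fintype.card ι := by
  unfold twistSet
  rw [Finset.card_image_of_injective _ (fun a b h => hg (by simpa using h)), Finset.card_univ]

/-- Counting the twist set inside a subset `S` is counting the twists `i` with `s (g i)⁻¹ ∈ S`. -/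
theorem card_inter_twistSet (g : ι → G) (hg : Function.Injective g) (s : G) (S : Finset G) :
    (twistSet g s ∩ S).card = (univ.filter fun i => s * (g i)⁻¹ ∈ S).card := by
  unfold twistSet
  rw [← Finset.filter_mem_eq_inter, Finset.filter_image,
    Finset.card_image_of_injective _ (fun a b h => hg (by simpa using h))]

/-- **Lemma R, single class** (§7.7 (R2)): if the four corners are the twists `Φ · g i` of ONE CM type
`Φ` by pairwise distinct `g i`, then for every embedding `s` the twist set `{s (g i)⁻¹ : i}` is a
Pohlmann (Hodge) set of `Φ` itself: the face class is the exceptional class `H^{|ι|}(A)_{U_s}` on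
`A = A_Φ`. -/
theorem isHodgeSet_twistSet {c : G} (hc : IsComplexConj c) (Φ : Finset G) (g : ι → G)
    (hg : Function.Injective g) (hsum : SumTwo fun i => rmul Φ (g i)) (s : G) :
    IsHodgeSet c Φ (twistSet g s) := by
  rw [isHodgeSet_iff_forall_inter_eq]
  intro h
  rw [card_inter_twistSet g hg, card_inter_twistSet g hg]
  have key : ∀ (x : G) (i : ι), s * (g i)⁻¹ ∈ x • Φ ↔ x⁻¹ * s ∈ rmul Φ (g i) := by
    intro x i
    rw [← inv_smul_mem_iff, smul_eq_mul, mem_rmul, mul_assoc]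
  have h1 : (univ.filter fun i => s * (g i)⁻¹ ∈ h • Φ).card = 2 := by
    simp only [key]; exact hsum (h⁻¹ * s)
  have h2 : (univ.filter fun i => s * (g i)⁻¹ ∈ h • c • Φ).card = 2 := by
    have key' : ∀ i, s * (g i)⁻¹ ∈ h • c • Φ ↔ c * h⁻¹ * s ∈ rmul Φ (g i) := by
      intro i
      rw [smul_smul, key, _root_.mul_inv_rev, hc.inv_eq]
    simp only [key']; exact hsum (c * h⁻¹ * s)
  rw [h1, h2]

/-- In the single-class case exactly two of the `|ι|` elements of the twist set lie in each translate
`h Φ` (`p = 2` for a rank-four face). -/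
theorem card_inter_twistSet_smul_eq_two (Φ : Finset G) (g : ι → G) (hg : Function.Injective g)
    (hsum : SumTwo fun i => rmul Φ (g i)) (s h : G) : (twistSet g s ∩ h • Φ).card = 2 := by
  rw [card_inter_twistSet g hg]
  have key : ∀ i, s * (g i)⁻¹ ∈ h • Φ ↔ h⁻¹ * s ∈ rmul Φ (g i) := by
    intro i
    rw [← inv_smul_mem_iff, smul_eq_mul, mem_rmul, mul_assoc]
  simp only [key]; exact hsum (h⁻¹ * s)

end SingleClass

/-! ### Bridge: the product criterion on one factor is `IsHodgeSet` -/

section OneFactor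

/-- A subset of `G` as a subset of `Unit × G`. -/
def toProdUnit (Δ : Finset G) : Finset (Unit × G) :=
  Δ.map ⟨fun y => ((), y), fun _ _ h => by simpa using h⟩

omit [Group G] in
/-- Filtering `toProdUnit Δ` is filtering `Δ`. -/
theorem card_filter_toProdUnit (Δ : Finset G) (P : Unit × G → Prop) [DecidablePred P] :
    ((toProdUnit Δ).filter P).card = (Δ.filter fun y => P ((), y)).card := by
  unfold toProdUnit
  rw [Finset.filter_map, Finset.card_map]
  rfl

variable [DecidableEq G]

/-- `|τΔ ∩ S| = #{y ∈ Δ : τ y ∈ S}`. -/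
theorem card_smul_inter_eq_card_filter (τ : G) (Δ S : Finset G) :
    (τ • Δ ∩ S).card = (Δ.filter fun y => τ * y ∈ S).card := by
  rw [card_smul_inter, ← Finset.filter_mem_eq_inter]
  congr 1
  ext y
  simp [mem_inv_smul_finset_iff]

/-- For a single factor the product criterion is Pohlmann's criterion `IsHodgeSet`. -/
theorem isHodgeSetProd_toProdUnit_iff (c : G) (Φ Δ : Finset G) :
    IsHodgeSetProd c (fun _ : Unit => Φ) (toProdUnit Δ) ↔ IsHodgeSet c Φ Δ := by
  unfold IsHodgeSetProd IsHodgeSet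
  refine forall_congr' fun τ => ?_
  rw [card_filter_toProdUnit, card_filter_toProdUnit, card_smul_inter_eq_card_filter,
    card_smul_inter_eq_card_filter]

end OneFactor

/-! ### The product criterion: weight form and translation invariance -/

section ProdCriterion

variable {J : Type*} [DecidableEq G] [Fintype G]

/-- For a product of CM types the two filters of `IsHodgeSetProd` partition `Δ`. -/
theorem card_filter_add_card_filter_conj {c : G} (hc : IsComplexConj c) {Φ : J → Finset G}
    (hΦ : ∀ k, IsCMType c (Φ k)) (Δ : Finset (J × G)) (τ : G) :
    (Δ.filter fun q => τ * q.2 ∈ Φ q.1).card + (Δ.filter fun q => τ * q.2 ∈ c • Φ q.1).card =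
      Δ.card := by
  rw [← Finset.card_filter_add_card_filter_not (s := Δ) (fun q : J × G => τ * q.2 ∈ Φ q.1)]
  congr 2
  refine Finset.filter_congr fun q _ => ?_
  rw [(hΦ q.1).smul_eq_compl hc, Finset.mem_compl]

/-- Weight form of the product criterion: `2 · #{(k, y) ∈ Δ : τ y ∈ Φ k} = |Δ|` for all `τ`
([Gordon] §9.2.2 (b) for the product). -/
theorem isHodgeSetProd_iff_two_mul {c : G} (hc : IsComplexConj c) {Φ : J → Finset G}
    (hΦ : ∀ k, IsCMType c (Φ k)) (Δ : Finset (J × G)) :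
    IsHodgeSetProd c Φ Δ ↔ ∀ τ : G, 2 * (Δ.filter fun q => τ * q.2 ∈ Φ q.1).card = Δ.card := by
  unfold IsHodgeSetProd
  refine forall_congr' fun τ => ?_
  have h := card_filter_add_card_filter_conj hc hΦ Δ τ
  omega

/-- A subset satisfying the product criterion has even cardinality. -/
theorem IsHodgeSetProd.even_card {c : G} (hc : IsComplexConj c) {Φ : J → Finset G}
    (hΦ : ∀ k, IsCMType c (Φ k)) {Δ : Finset (J × G)} (h : IsHodgeSetProd c Φ Δ) : Even Δ.card := by
  rw [isHodgeSetProd_iff_two_mul hc hΦ] at h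
  exact ⟨(Δ.filter fun q => (1 : G) * q.2 ∈ Φ q.1).card, by rw [← h 1]; ring⟩

/-- The simultaneous left translation of a subset of `J × G`. -/
def prodSmul (g : G) (Δ : Finset (J × G)) : Finset (J × G) :=
  Δ.map ⟨fun q => (q.1, g * q.2), fun a b h => by
    simp only [Prod.mk.injEq, mul_right_inj] at h; exact Prod.ext h.1 h.2⟩

omit [DecidableEq G] [Fintype G] in
/-- Membership in the simultaneous translate. -/
theorem mem_prodSmul (g : G) (Δ : Finset (J × G)) (q : J × G) :
    q ∈ prodSmul g Δ ↔ (q.1, g⁻¹ * q.2) ∈ Δ := by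
  unfold prodSmul
  rw [Finset.mem_map]
  constructor
  · rintro ⟨a, ha, rfl⟩; simpa using ha
  · intro h; exact ⟨(q.1, g⁻¹ * q.2), h, by simp⟩

omit [Fintype G] in
/-- The product criterion is stable under the Galois action on the subset. -/
theorem IsHodgeSetProd.prodSmul {c : G} {Φ : J → Finset G} {Δ : Finset (J × G)}
    (h : IsHodgeSetProd c Φ Δ) (g : G) : IsHodgeSetProd c Φ (HodgeRepro.prodSmul g Δ) := by
  intro τ
  have key : ∀ S : J → Finset G, ((HodgeRepro.prodSmul g Δ).filter fun q => τ * q.2 ∈ S q.1).card =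
      (Δ.filter fun q => (τ * g) * q.2 ∈ S q.1).card := by
    intro S
    unfold HodgeRepro.prodSmul
    rw [Finset.filter_map, Finset.card_map]
    congr 1
    ext q
    simp [mul_assoc]
  rw [key Φ, key (fun k => c • Φ k)]
  exact h (τ * g)

end ProdCriterion

end HodgeRepro
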